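import Summits.NavierStokesRegularity.NavierStokesRegularity.Theorems.ExtremiserTransienceDissipationLedgerDefs
import Summits.NavierStokesRegularity.NavierStokesRegularity.Theorems.ExtremiserTransienceMemberSelection
import HarnessLib

/-!
# Route `ExtremiserTransience`, crux `NearExtremalTransiencePerFlow` (stmt-NavierStokesRegularity-26567),
# LINE g10-β «tight-or-chain»: THE VOCABULARY OF THE LINE (texts of record)

Texts of record, VERBATIM §0–§1b of the registered skeleton of record
`Cruxes/NearExtremalTransiencePerFlow/Lines/tight_or_chain.lean` (planner ns-idea-5 g10, skeleton sha 0c90497d1ce4; `E3` spelled out as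
`EuclideanSpace ℝ (Fin 3)`), MINUS what is already of record: `HasLinGrowthAllTime`, `dissMeasure`, `ViolatorDissipation` are REUSED from
`Theorems/ExtremiserTransienceDissipationLedgerDefs.lean` (namespace `…Theorems.NearExtremalTransiencePerFlow.DissipationLedger`, byte-identical
bodies, so the β workfile's statements unfold to the same terms), `NearExtremalFamily` from `…MemberSelectionDefs`, `IsExtremalSlice` from
`…MemberSelection`.  Declared here:

* `ChainUpTo g η w z₀ d`, `ChainsOfEveryLength g η w` — level chains (the honest, limit-stable witness of the non-tight branch);
* `UniformDissipationBudget` (L1ᵘ, the registered stub `stub_uniformDissipationBudget`), `LedgerCountLocal` (L3ˡᵒᶜ, proved in the line),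
  `LocalChainLiouville` (the line's intermediate Liouville statement), `TightOrChain` (T♮, the registered heart `stub_tightOrChain`),
  `TightOrChainMembers`, `TightOrClusterGrowth` (member-level forms of T♮).

So that the registered stubs can be landed BY NAME from `Theorems/` (`theorem stub_uniformDissipationBudget : UniformDissipationBudget`,
`theorem stub_tightOrChain : TightOrChain` inside this namespace) and the line's kernel-checked reductions can be ported Theorems-side.
Author: prover seat `ns-net-p1` (g11).  HONEST FRAMING: definitions only; nothing about Navier–Stokes regularity or blow-up is proved; no
summit is proved by a line.
-/

noncomputable section

open scoped Topology ENNReal ContDiff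
open MeasureTheory Filter Set Metric
open Literature.Analysis.FluidPDE
open Summit.NavierStokesRegularity.NavierStokesRegularity.Theorems.NearExtremalTransiencePerFlow.MemberSelection
open Summit.NavierStokesRegularity.NavierStokesRegularity.Theorems.NearExtremalTransiencePerFlow.DissipationLedger

namespace Summit.NavierStokesRegularity.NavierStokesRegularity.Theorems.NearExtremalTransiencePerFlow.TightOrChain

-- the problem directory repeats the summit name (`NavierStokesRegularity/NavierStokesRegularity`)
set_option linter.dupNamespace false

/-- A LEVEL CHAIN OF LENGTH `d` ABOUT `z₀` (thickness `g`, level `η`): the level set `{‖w‖ ≥ η}` meets the `g`-neighbourhood of every sphere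
`{‖z - z₀‖ = r}`, `0 ≤ r ≤ d`. -/
def ChainUpTo (g η : ℝ) (w : EuclideanSpace ℝ (Fin 3) → EuclideanSpace ℝ (Fin 3)) (z₀ : EuclideanSpace ℝ (Fin 3)) (d : ℝ) : Prop :=
  ∀ r : ℝ, 0 ≤ r → r ≤ d → ∃ z : EuclideanSpace ℝ (Fin 3), |‖z - z₀‖ - r| ≤ g ∧ η ≤ ‖w z‖

/-- CHAINS OF EVERY LENGTH (centres may depend on the length). -/
def ChainsOfEveryLength (g η : ℝ) (w : EuclideanSpace ℝ (Fin 3) → EuclideanSpace ℝ (Fin 3)) : Prop :=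
  ∀ d : ℝ, ∃ z₀ : EuclideanSpace ℝ (Fin 3), ChainUpTo g η w z₀ d

/-- (L1ᵘ) UNIFORM DISSIPATION BUDGET: for all `K, A` there is `E = E(K,A)` such that every Type-I ancient mild field (constant `K`) with
all-time linear growth `A` dissipates at most `E·R` in every parabolic cylinder `[τ₁,τ₂] × B(x,R)` with `-τ₁ ≤ R²` (`τ₁ < τ₂ < 0`). -/
def UniformDissipationBudget : Prop :=
  ∀ (K A : ℝ), ∃ E : ℝ, ∀ (W : ℝ → EuclideanSpace ℝ (Fin 3) → EuclideanSpace ℝ (Fin 3)),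
    IsTypeIAncientMild K W → HasLinGrowthAllTime A W →
    ∀ (x : EuclideanSpace ℝ (Fin 3)) (R τ₁ τ₂ : ℝ), 0 < R → τ₁ < τ₂ → τ₂ < 0 → -τ₁ ≤ R ^ 2 →
      dissMeasure W (Set.Icc τ₁ τ₂ ×ˢ Metric.ball x R) ≤ ENNReal.ofReal (E * R)

/-- (L3ˡᵒᶜ) THE LOCAL LEDGER COUNT: for the constants `s < 0`, `g ≥ 0`, `ρ, c, D > 0`, `0 < a < 1`, `E` there is an explicit radius `R₀ > 0`
such that for every measure `μ` on `ℝ × ℝ³`, predicate `P` and centre `x₀`: (U) `P`-points at time `s` within `g` of every sphere about `x₀`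
of radius `≤ R₀`, (Per) one-step backward propagation with drift `ρ√(-τ)`, (Spend) `c√(-τ)` per `P`-point on its box, (Budget)
`μ([τ₁,τ₂] × B(x₀,R)) ≤ E·R` when `-τ₁ ≤ R²` — are contradictory. -/
def LedgerCountLocal : Prop :=
  ∀ (s g ρ c D a E : ℝ), s < 0 → 0 ≤ g → 0 < ρ → 0 < c → 0 < D → 0 < a → a < 1 →
    ∃ R₀ : ℝ, 0 < R₀ ∧ ∀ (μ : Measure (ℝ × EuclideanSpace ℝ (Fin 3))) (P : ℝ → EuclideanSpace ℝ (Fin 3) → Prop)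
      (x₀ : EuclideanSpace ℝ (Fin 3)),
      (∀ r : ℝ, 0 ≤ r → r ≤ R₀ → ∃ z : EuclideanSpace ℝ (Fin 3), |‖z - x₀‖ - r| ≤ g ∧ P s z) →
      (∀ (τ : ℝ) (x : EuclideanSpace ℝ (Fin 3)), τ < 0 → P τ x →
        ∃ x' : EuclideanSpace ℝ (Fin 3), ‖x' - x‖ ≤ ρ * Real.sqrt (-τ) ∧ P (36 * τ) x') →
      (∀ (τ : ℝ) (x : EuclideanSpace ℝ (Fin 3)), τ < 0 → P τ x →
        ENNReal.ofReal (c * Real.sqrt (-τ)) ≤ μ (Set.Icc ((1 + a) * τ) τ ×ˢ Metric.ball x (D * Real.sqrt (-τ)))) →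
      (∀ (R τ₁ τ₂ : ℝ), 0 < R → τ₁ < τ₂ → τ₂ < 0 → -τ₁ ≤ R ^ 2 →
        μ (Set.Icc τ₁ τ₂ ×ˢ Metric.ball x₀ R) ≤ ENNReal.ofReal (E * R)) →
      False

/-- LOCAL CHAIN LIOUVILLE: for all `K, A, g`, `η > 0`, `s < 0` there is a length `d > 0` such that no slice `W s` of a Type-I ancient mild
field (constant `K`) with all-time linear growth `A` carries a level-`η` chain of thickness `g` and length `d` about any centre. -/
def LocalChainLiouville : Prop :=
  ∀ (K A g η s : ℝ), s < 0 → 0 < η → ∃ d : ℝ, 0 < d ∧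
    ∀ (W : ℝ → EuclideanSpace ℝ (Fin 3) → EuclideanSpace ℝ (Fin 3)) (z₀ : EuclideanSpace ℝ (Fin 3)),
      IsTypeIAncientMild K W → HasLinGrowthAllTime A W → ¬ ChainUpTo g η (W s) z₀ d

/-- (T♮ — THE HEART) TIGHT-OR-CHAIN: a near-extremal height-`1` family (`NearExtremalFamily v Λ Θ ε`) whose members eventually have linear
growth `A` admits centres `y`, a subsequence `φ` and a pointwise limit `W₀` of the translates `v (φ n) (y (φ n) + ·)` such that EITHER `W₀`
is an exactly extremal extended slice (`IsExtremalSlice`; the tight branch) OR `W₀` has level-`η` chains of thickness `g` of every length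
(`η > 0`; the non-tight branch). -/
def TightOrChain : Prop :=
  ∀ (v : ℕ → EuclideanSpace ℝ (Fin 3) → EuclideanSpace ℝ (Fin 3)) (Λ : ℕ → ℝ) (Θ : ℝ) (ε : ℕ → ℝ) (A : ℝ),
    NearExtremalFamily v Λ Θ ε →
    (∀ᶠ n in atTop, ∀ (x : EuclideanSpace ℝ (Fin 3)) (R : ℝ), 0 < R →
      ∫ z in Metric.ball x R, ‖v n z‖ ^ 2 ≤ A * R) →
    ∃ (y : ℕ → EuclideanSpace ℝ (Fin 3)) (φ : ℕ → ℕ) (W₀ : EuclideanSpace ℝ (Fin 3) → EuclideanSpace ℝ (Fin 3)),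
      StrictMono φ ∧
      (∀ z : EuclideanSpace ℝ (Fin 3), Tendsto (fun n => v (φ n) (y (φ n) + z)) atTop (𝓝 (W₀ z))) ∧
      (IsExtremalSlice W₀ ∨ ∃ g η : ℝ, 0 < η ∧ ChainsOfEveryLength g η W₀)

/-- T♮ AT MEMBER LEVEL: the same dichotomy, with the chain branch stated on the MEMBERS about the chosen centres — chains of thickness `g`,
level `η`, up to lengths `d n → ∞` — instead of on the limit. -/
def TightOrChainMembers : Prop :=
  ∀ (v : ℕ → EuclideanSpace ℝ (Fin 3) → EuclideanSpace ℝ (Fin 3)) (Λ : ℕ → ℝ) (Θ : ℝ) (ε : ℕ → ℝ) (A : ℝ),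
    NearExtremalFamily v Λ Θ ε →
    (∀ᶠ n in atTop, ∀ (x : EuclideanSpace ℝ (Fin 3)) (R : ℝ), 0 < R →
      ∫ z in Metric.ball x R, ‖v n z‖ ^ 2 ≤ A * R) →
    ∃ (y : ℕ → EuclideanSpace ℝ (Fin 3)) (φ : ℕ → ℕ) (W₀ : EuclideanSpace ℝ (Fin 3) → EuclideanSpace ℝ (Fin 3)),
      StrictMono φ ∧
      (∀ z : EuclideanSpace ℝ (Fin 3), Tendsto (fun n => v (φ n) (y (φ n) + z)) atTop (𝓝 (W₀ z))) ∧
      (IsExtremalSlice W₀ ∨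
        ∃ g η : ℝ, 0 < η ∧ ∃ d : ℕ → ℝ, Tendsto d atTop atTop ∧ ∀ n, ChainUpTo g η (v (φ n)) (y (φ n)) (d n))

/-- T♮ VIA CLUSTER GROWTH (member level): tight, OR for some thickness `g ≥ 0` and level `η > 0` the members carry `g`-WALKS of level points
from the centres reaching distances `d n → ∞`. -/
def TightOrClusterGrowth : Prop :=
  ∀ (v : ℕ → EuclideanSpace ℝ (Fin 3) → EuclideanSpace ℝ (Fin 3)) (Λ : ℕ → ℝ) (Θ : ℝ) (ε : ℕ → ℝ) (A : ℝ),
    NearExtremalFamily v Λ Θ ε →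
    (∀ᶠ n in atTop, ∀ (x : EuclideanSpace ℝ (Fin 3)) (R : ℝ), 0 < R →
      ∫ z in Metric.ball x R, ‖v n z‖ ^ 2 ≤ A * R) →
    ∃ (y : ℕ → EuclideanSpace ℝ (Fin 3)) (φ : ℕ → ℕ) (W₀ : EuclideanSpace ℝ (Fin 3) → EuclideanSpace ℝ (Fin 3)),
      StrictMono φ ∧
      (∀ z : EuclideanSpace ℝ (Fin 3), Tendsto (fun n => v (φ n) (y (φ n) + z)) atTop (𝓝 (W₀ z))) ∧
      (IsExtremalSlice W₀ ∨
        ∃ g η : ℝ, 0 ≤ g ∧ 0 < η ∧ ∃ d : ℕ → ℝ, Tendsto d atTop atTop ∧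
          ∀ n, ∃ (N : ℕ) (p : ℕ → EuclideanSpace ℝ (Fin 3)), p 0 = y (φ n) ∧ (∀ i, i ≤ N → η ≤ ‖v (φ n) (p i)‖) ∧
            (∀ i, i < N → ‖p (i + 1) - p i‖ ≤ g) ∧ d n ≤ ‖p N - y (φ n)‖)

end Summit.NavierStokesRegularity.NavierStokesRegularity.Theorems.NearExtremalTransiencePerFlow.TightOrChain

end
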